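import Summits.BirchSwinnertonDyer.BirchSwinnertonDyer.Theorems.AlignedTransportAtTwoMainConjectureOfRankZeroBSDAtTwoSelmerLayerMuDoor
import HarnessLib

/-!
# Route `AlignedTransportAtTwo`, crux C2 `MainConjectureOfRankZeroBSDAtTwo` (stmt-BirchSwinnertonDyer-22298):
# THE ONE-LAYER form of the Selmer rank-jump `μ`-door — `#Sel_n[p] · #ker g_n < p^{pⁿ}` at ONE layer `n` forces `μ(X) = 0`
# (at `p = 2`: `rk₂ Sel_{2^∞}(E/ℚ_n)[2] + log₂ #ker g_n < 2ⁿ`; first possible at `n = 2`, ONE `2`-descent over `ℚ(ζ₁₆)⁺`)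

HONEST FRAMING (cell `bsd-f1-sign2`, WIDTH-5 attached prover seat `bsd-line-att-p5` gen 43 on line `birth` of the lead
`bsd-line-att-p2`; `--supports` stmt-BirchSwinnertonDyer-22298, closes nothing; BSD is NOT proved by any of this; the crux
C2, its verdict «blocked-on `Rank1Residual.GreenbergMuConjectureIrreducible`» and every registered stub are untouched).
THEOREMS ONLY — no `def`, no instance, no named fact, no `sorry`. PLACEMENT: COROLLARY-OF-TREE — the case `a = 0` of this seat's
`IwasawaModuleRankJump.muInvariant_eq_zero_of_card_lt` (`Q_0 = M/(T⁰, p)M = 0`), equivalently the case `m = 0` of cell `bsd-2adic`'s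
tower gap `X5.TowerGap.isTorsion_and_mu_eq_zero_of_card_quotient_lt` (2026-08-28); recorded because it is the form a descent engine runs
FIRST (one layer, no lower layer needed), in the lineage's Selmer currency and for every number field.

* §1 (`Λ`-algebra, any finitely generated `Λ`-module `M`): `natCard_quotient_pow_zero_eq_one` (`#M/(T⁰,p)M = 1`);
  ★ `mu_eq_zero_of_card_layerQuotient_lt_pow` — **`#M/(ω_n, p)M < p^{pⁿ}` for ONE `n` ⟹ `M` torsion, `μ(M) = 0`, `M` f.g. over `ℤ_p`,
  `p^{λ(M)} ≤ #M/(ω_n,p)M`** (`dim_{𝔽_p} (M/pM)/T^{pⁿ} ≥ r·pⁿ`, `r` the `𝔽_p⟦T⟧`-rank of `M/pM`).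
* §2 (any number field `K`, any `ℤ_p`-extension with topological generator, any dual datum with `X` f.g., `h_n` injective, `ker g_n` finite):
  ★★ `isTorsion_and_mu_eq_zero_of_selmer_oneLayer` — **`#Sel_n[p] · #ker g_n < p^{pⁿ}` ⟹ `X` torsion, `μ(X) = 0`, `p^{λ(X)} ≤ #Sel_n[p]·#ker g_n`.**
* §3 over `ℚ`: `…_rat` (every good ordinary `p`, `κ` cyclotomic, `E(ℚ_∞)[p^∞] = 0`); ★★★ `seedMuZero_of_selmer_oneLayer_two` — for every `W/ℚ`
  good ordinary at `2` without rational `2`-torsion, cyclotomic `κ`, top. generator `γ`, dual datum `D`, ONE layer `n` with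
  `#Sel_n[2]·#ker g_n < 2^{2ⁿ}` gives `D.IsTorsion ∧ D.mu = 0` (stub T at `(W,κ,γ,D)`). Since `#ker g_n ≥ #Ẽ(𝔽₂)(2)² ≥ 4`, the first
  layer where this can hold is `n = 2` (`ℚ_2 = ℚ(ζ₁₆)⁺`, quartic): e.g. `a₂ = +1`, no `2`-adic contribution from bad primes
  (`#ker g_2 = 4`) and `rk₂ Sel_{2^∞}(E/ℚ(ζ₁₆)⁺)[2] ≤ 1`.

References: L. Washington, GTM 83, §13.2–13.3 [Washington1997]; T. Fukuda, Proc. Japan Acad. 70 (1994) [Fukuda1994]; R. Greenberg, LNM 1716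
(1999), §1 Conj. 1.11, §3 Lemmas 3.1–3.4 [GreenbergLNM1716].
-/

set_option linter.dupNamespace false
set_option autoImplicit false

noncomputable section

open scoped Classical AddSubgroup

universe u

namespace Summit.BirchSwinnertonDyer.BirchSwinnertonDyer.Theorems.AlignedTransportAtTwoSelmerLayerMuDoorOneLayer

open PowerSeries WeierstrassCurve Literature.NumberTheory.EllipticCurves Literature.NumberTheory.EllipticCurves.IwasawaDual
  Literature.NumberTheory.EllipticCurves.IwasawaAlgebra Literature.NumberTheory.IwasawaTheory.IwasawaModuleRankJump
  Literature.NumberTheory.EllipticCurves.Greenberg1999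
  Summit.BirchSwinnertonDyer.BirchSwinnertonDyer.Theorems.AlignedTransportAtTwoSelmerLayerModel
  Summit.BirchSwinnertonDyer.BirchSwinnertonDyer.Theorems.AlignedTransportAtTwoSelmerLayerDuality
  Summit.BirchSwinnertonDyer.BirchSwinnertonDyer.Theorems.AlignedTransportAtTwoSelmerLayerMuDoorCount
  Summit.BirchSwinnertonDyer.BirchSwinnertonDyer.Theorems.AlignedTransportAtTwoSelmerLayerMuDoor
  Summit.BirchSwinnertonDyer.BirchSwinnertonDyer.Theorems.AlignedTransportAtTwoSelmerLayerAllPrimes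

/-! ## §1 One layer, `Λ`-algebra -/

section Algebra

variable {p : ℕ} [hp : Fact p.Prime] {M : Type u} [AddCommGroup M] [Module (IwasawaAlgebra p) M]

/-- `M/(T⁰, p)M = M/M` has one element. [folklore] -/
theorem natCard_quotient_pow_zero_eq_one :
    Nat.card (M ⧸ (Ideal.span {(X : IwasawaAlgebra p) ^ 0} ⊔ augIdealP p) • (⊤ : Submodule (IwasawaAlgebra p) M)) = 1 := by
  have h : (Ideal.span {(X : IwasawaAlgebra p) ^ 0} ⊔ augIdealP p) • (⊤ : Submodule (IwasawaAlgebra p) M) = ⊤ := by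
    rw [pow_zero, Ideal.span_singleton_one, top_sup_eq, Submodule.top_smul]
  rw [h]
  exact Nat.card_unique

variable [Module.Finite (IwasawaAlgebra p) M]

/-- ★ **ONE LAYER: `#M/(ω_n, p)M < p^{pⁿ}` ⟹ `M` torsion, `μ(M) = 0`, `M` finitely generated over `ℤ_p`, `p^{λ(M)} ≤ #M/(ω_n, p)M`**
(the rank jump between `T⁰` and `T^{pⁿ}`: `(ω_n, p) = (T^{pⁿ}, p)`, `#M/(T⁰,p)M = 1`). [cite: Washington1997, §13.3 Prop. 13.22–13.23]
[cite: Fukuda1994, Thm. 1] -/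
theorem mu_eq_zero_of_card_layerQuotient_lt_pow (n : ℕ)
    (hlt : Nat.card (M ⧸ (Ideal.span {((1 + X) ^ p ^ n - 1 : IwasawaAlgebra p)} ⊔ augIdealP p) •
      (⊤ : Submodule (IwasawaAlgebra p) M)) < p ^ (p ^ n)) :
    Module.IsTorsion (IwasawaAlgebra p) M ∧ muInvariant p M = 0 ∧
      Module.Finite ℤ_[p] (RestrictScalars ℤ_[p] (IwasawaAlgebra p) M) ∧
      p ^ lambdaInvariant p M ≤ Nat.card (M ⧸ (Ideal.span {((1 + X) ^ p ^ n - 1 : IwasawaAlgebra p)} ⊔ augIdealP p) •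
        (⊤ : Submodule (IwasawaAlgebra p) M)) := by
  rw [omega_smul_top_eq] at hlt ⊢
  have hab : 0 < p ^ n := pow_pos hp.out.pos n
  have hlt' : Nat.card (M ⧸ (Ideal.span {(X : IwasawaAlgebra p) ^ (p ^ n)} ⊔ augIdealP p) •
        (⊤ : Submodule (IwasawaAlgebra p) M)) * p ^ 0 <
      Nat.card (M ⧸ (Ideal.span {(X : IwasawaAlgebra p) ^ 0} ⊔ augIdealP p) • (⊤ : Submodule (IwasawaAlgebra p) M)) *
        p ^ (p ^ n) := by
    rw [pow_zero, mul_one, natCard_quotient_pow_zero_eq_one, one_mul]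
    exact hlt
  exact ⟨isTorsion_of_card_lt hab hlt', muInvariant_eq_zero_of_card_lt hab hlt', moduleFinite_padicInt_of_card_lt hab hlt',
    pow_lambdaInvariant_le_of_card_lt hab hlt'⟩

end Algebra

/-! ## §2 One layer, Selmer currency, any number field -/

section Door

variable {K : Type u} [Field K] [NumberField K] (W : WeierstrassCurve K) {p : ℕ} [hp : Fact p.Prime]
  (κ : ZpExtension K p) {γ : Field.absoluteGaloisGroup K}

/-- ★★ **ONE-LAYER SELMER `μ`-DOOR (any number field `K`, any `ℤ_p`-extension with topological generator `γ`, any dual datum with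
`X` finitely generated):** if `h_n` is injective (e.g. `E(K_∞)[p^∞] = 0`), `ker g_n` is finite and `#Sel_n[p] · #ker g_n < p^{pⁿ}`
(`Sel_n = W.selmerLayer κ n`), then `X` is `Λ`-torsion, `μ(X) = 0`, `X` is finitely generated over `ℤ_p` and `p^{λ(X)} ≤ #Sel_n[p]·#ker g_n`.
[cite: GreenbergLNM1716, §1 pp. 60–62, §3 Lemma 3.1, §4 Lemma 4.3] [cite: Washington1997, §13.3 Prop. 13.23] -/
theorem isTorsion_and_mu_eq_zero_of_selmer_oneLayer (hγ : κ.IsTopGenerator γ) (D : W.SelmerDualData κ γ)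
    [Module.Finite (IwasawaAlgebra p) D.X] (n : ℕ) (hinj : Function.Injective (W.layerToInfty κ n)) [Finite (W.KerG κ n)]
    (hlt : Nat.card ((↥(W.selmerLayer κ n))[(p : ℤ)]) * Nat.card (W.KerG κ n) < p ^ (p ^ n)) :
    D.IsTorsion ∧ D.mu = 0 ∧ Module.Finite ℤ_[p] (RestrictScalars ℤ_[p] (IwasawaAlgebra p) D.X) ∧
      p ^ D.lambda ≤ Nat.card ((↥(W.selmerLayer κ n))[(p : ℤ)]) * Nat.card (W.KerG κ n) := by
  haveI := finite_torsionBy_selmerInvariants p W κ hγ D n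
  have hQ := natCard_layerQuotientP_eq_natCard_torsionBy_selmerInvariants p W κ hγ D n
  have hup := natCard_torsionBy_selmerInvariants_le W κ n hinj
  have hlt' : Nat.card (D.X ⧸ (Ideal.span {((1 + X) ^ p ^ n - 1 : IwasawaAlgebra p)} ⊔ augIdealP p) •
      (⊤ : Submodule (IwasawaAlgebra p) D.X)) < p ^ (p ^ n) := by
    rw [hQ]
    exact hup.trans_lt hlt
  obtain ⟨hT, hμ, hfg, hlam⟩ := mu_eq_zero_of_card_layerQuotient_lt_pow (M := D.X) n hlt'
  rw [hQ] at hlam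
  exact ⟨hT, hμ, hfg, hlam.trans hup⟩

end Door

/-! ## §3 Over `ℚ` -/

section Rat

open Summit.BirchSwinnertonDyer.BirchSwinnertonDyer.Theorems.AlignedTransportAtTwoFineRoad

variable (W : WeierstrassCurve ℚ) [W.IsElliptic] [W.IsGloballyMinimal] {p : ℕ} [hp : Fact p.Prime]
  (κ : ZpExtension ℚ p) {γ : Field.absoluteGaloisGroup ℚ}

/-- ★★ **One layer over `ℚ` at a good ordinary `p`** (`κ` cyclotomic, `γ` a topological generator, `E(ℚ_∞)[p^∞] = 0`, ANY dual datum):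
`#Sel_n[p]·#ker g_n < p^{pⁿ}` at ONE layer `n` ⟹ `X` torsion, `μ(X) = 0`, `p^{λ} ≤ #Sel_n[p]·#ker g_n` — finite generation and the finiteness of
`ker g_n` are theorems (`module_finite_of_isCyclotomic`, g42 `finite_kerG_of_isOrdinaryAt`).
[cite: GreenbergLNM1716, §1 Conj. 1.11, §3 Lemmas 3.1–3.4] [cite: Washington1997, §13.3 Prop. 13.23] -/
theorem isTorsion_and_mu_eq_zero_of_selmer_oneLayer_rat (hord : IsOrdinaryAt W p)
    (hB : FixedPoints.addSubgroup κ.kerSubgroup (W.geomPrimaryTorsion p) = ⊥) (hκ : κ.IsCyclotomic)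
    (hγ : κ.IsTopGenerator γ) (D : W.SelmerDualData κ γ) (n : ℕ)
    (hlt : Nat.card ((↥(W.selmerLayer κ n))[(p : ℤ)]) * Nat.card (W.KerG κ n) < p ^ (p ^ n)) :
    D.IsTorsion ∧ D.mu = 0 ∧ Module.Finite ℤ_[p] (RestrictScalars ℤ_[p] (IwasawaAlgebra p) D.X) ∧
      p ^ D.lambda ≤ Nat.card ((↥(W.selmerLayer κ n))[(p : ℤ)]) * Nat.card (W.KerG κ n) := by
  haveI : Module.Finite (IwasawaAlgebra p) D.X := SelmerDualData.module_finite_of_isCyclotomic W κ hκ D hγ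
  haveI : Finite (W.KerG κ n) := finite_kerG_of_isOrdinaryAt W hord hκ n
  exact isTorsion_and_mu_eq_zero_of_selmer_oneLayer W κ hγ D n (layerToInfty_injective_of_fixedPoints_eq_bot W κ hγ hB n) hlt

/-- ★★★ **STUB T AT `(W, κ, γ, D)` FROM ONE `2`-DESCENT.** For every `W/ℚ` (globally minimal, elliptic) good ordinary at `2` without a
rational point of order `2`, the cyclotomic `ℤ₂`-extension `κ` with topological generator `γ`, ANY dual datum `D` and ONE layer `n` with
**`#Sel_n[2] · #ker g_n < 2^{2ⁿ}`** (`Sel_n = W.selmerLayer κ n ≃ Sel_{2^∞}(E_{ℚ_n}/ℚ_n)`): `D.IsTorsion ∧ D.mu = 0 ∧ 2^{D.lambda} ≤ #Sel_n[2]·#ker g_n`.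
Since `#ker g_n ≥ 4` at `2`, the first usable layer is `n = 2` (`ℚ_2 = ℚ(ζ₁₆)⁺`): `rk₂ Sel_{2^∞}(E/ℚ(ζ₁₆)⁺)[2] + log₂ #ker g_2 ≤ 3`.
[cite: GreenbergLNM1716, §1 Conj. 1.11; §3 Lemmas 3.1–3.4] [cite: Washington1997, §13.3 Prop. 13.23] [cite: Fukuda1994, Thm. 1] -/
theorem seedMuZero_of_selmer_oneLayer_two (hord : IsOrdinaryAt W 2) (ht : ∀ x : ℚ, ¬ HasRationalTwoTorsionX W x)
    (κ : ZpExtension ℚ 2) (hκ : κ.IsCyclotomic) {γ : Field.absoluteGaloisGroup ℚ} (hγ : κ.IsTopGenerator γ)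
    (D : W.SelmerDualData κ γ) (n : ℕ)
    (hlt : Nat.card ((↥(W.selmerLayer κ n))[(2 : ℤ)]) * Nat.card (W.KerG κ n) < 2 ^ (2 ^ n)) :
    D.IsTorsion ∧ D.mu = 0 ∧ Module.Finite ℤ_[2] (RestrictScalars ℤ_[2] (IwasawaAlgebra 2) D.X) ∧
      2 ^ D.lambda ≤ Nat.card ((↥(W.selmerLayer κ n))[(2 : ℤ)]) * Nat.card (W.KerG κ n) := by
  exact isTorsion_and_mu_eq_zero_of_selmer_oneLayer_rat W κ hord (fixedPoints_eq_bot_two W κ hκ ht) hκ hγ D n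
    (by exact_mod_cast hlt)

end Rat

end Summit.BirchSwinnertonDyer.BirchSwinnertonDyer.Theorems.AlignedTransportAtTwoSelmerLayerMuDoorOneLayer

end
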